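import Summits.ABC.IUTFork.Cor312OrbitExcursionBoxes
import HarnessLib

/-!
# [IUTchIII] Cor. 3.12 — the ORBIT-EXCURSION bed P♮ₑ (honest graded split model), II: pilot points, data, setting, region operator, q-datum

Record-only file (D-0012; MODEL DATA, no `Prop` fact) of the abc-iut cell (IUT REPAIR branch B, sub-cell B4 Dupuy–Hilado, seat
abc-iut-rp-h3 gen 2; rung LADDER-ABC:A2.B). TAKES NO SIDE on [IUTchIII] Cor. 3.12 and no side between Mochizuki, Scholze–Stix, Joshi or
Dupuy–Hilado. Sequel of `Cor312OrbitExcursionBoxes` (graded boxes `gbox k`, depths `depthAt`, the fine graded frame `excFrame`, the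
average-depth volume `excVol`) over abc-iut-w5-d230's split shells (`Cor312PilotKummerSplitShells` / `…SplitModel`, imported, not restated).

THE BED (this file = the model data; proofs in parts III `Cor312OrbitExcursionThm311` and IV `Cor312OrbitExcursionWitness`, the B4 evaluation in
`Repair/CandDupuyHilado33`):
* Θ-datum at label `j` = the pure tensor `pilotPt (2^{−j²})` (unit factors; LAST factor = `2^{−j²}` on the bad summand, `0` on the good one —
  [IUTchIII] Prop. 3.4 (ii): the theta value `q^{j²}` in the sub-packet `𝓘^ℚ(^{S^±_{j+1},j};−)_v`; Dupuy–Hilado §3.3 `P_{Θ,j} = Σ ord_v(q̲_v^{j²})[v]`);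
  q-datum `qDatumE` = `pilotPt (2^{−1})` (DH's `P_q = Σ ord_v(q̲_v)[v]` from the SAME Tate datum `q̲_v`) — a genuine point of the packet, NOT an
  ⟨(Ind1)∪(Ind2)⟩-translate of the Θ-datum;
* the region operator `gradedRegion` reads, on every coordinate through which the datum passes, the datum's depth (`pointDepth`): Θ-region
  `gbox (lastDepth j j²)` (depth `j²` on the `2^j` coordinates `c` with `c(j) = true`; volume `−j²/2`), q-region `gbox (lastDepth j 1)` (volume
  `−1/2`) — HONEST `j²`-scaling and label-INDEPENDENT q-volume (the two READING clauses of the ∀-countermodel p419757 HOLD here);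
* data (a)(b)(c) `excData` (integral structure the unit box `gbox 0`, everything admissible, volume `excVol`), column `excColumn` (identity Kummer
  transport), full situation `excFull` (link data abc-iut-w5-d247's `naiveLink`), setting `excSetting` (column `0`, honest pilot objects of
  exponent `1` via abc-iut-w4-d101's `ExpMonoid` / P♮₁'s `splitSig`, the GRADED frame, glue `thetaGlue`/`qGlue` reading the exponent);
* the (Ind1) capsule permutations carry `gbox (lastDepth j j²)` to the boxes deep on `{c | c(i) = true}`, `i ∈ S^±_{j+1}` — an EXCURSION — whose
  holomorphic hull is `gbox (topDepth j j²)` (deep on the single coordinate `c ≡ true`): volume `−j²/2^{j+1}`, i.e. `−1/4`, `−1/2` at `j = 1, 2`,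
  so `−|log(Θ)| = −3/8 > −1/2 = −|log(q)|` while `S` and the (xi-f) Licence FAIL (parts III–IV).
HONEST SCOPE: interface-level toy (`l⋇ = 2`, one place, rational «norms»); it models the MECHANISM of [IUTchIV] Thm. 1.10 Step (v) «symmetrizing
with respect to the choice of i† ∈ I» / DH-II §6.2 (6.3)–(6.8) read from below, not [IUTchI] Def. 3.1 data. No judgement on print; no `Prop`
fact; standard axioms. [claim: Mochizuki2012, status: disputed] for every IUT noun. [cite: DupuyHilado2020, §3.3, §4.7, §6.2]
[cite: ScholzeStix2018, §2.2 pp. 9–10]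
-/

noncomputable section

open Set

namespace Summit.ABC.IUTFork.Cor312Vol

namespace ExcursionWitness

open Thm311 Cor312 Cor312.IdentifiedNonVacuity NaiveWitness PinnedWitness SplitWitness Literature.IUT.LogThetaLattice


/-! ## 3. Depth profiles and the pilot points -/

/-- The LAST-FACTOR depth profile: depth `e` on the `2^j` coordinates through the bad summand of the last factor (`c(j) = true`), `0` on
the others — the shape of an honest Θ- or q-pilot region (theta value in the factor labeled `j`, [IUTchIII] Prop. 3.4 (ii); trivial at the
good valuation). [claim: Mochizuki2012, status: disputed] -/
def lastDepth (j : splitIndex.Label) (e : ℕ) : (splitIndex.Caps j → Bool) → ℕ := fun c => if c (Fin.last _) = true then e else 0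

/-- The TOP depth profile: depth `e` on the single coordinate `c ≡ true`, `0` elsewhere — the shape of the holomorphic hull of the
(Ind1)-orbit of `gbox (lastDepth j e)` (part II). [folklore] -/
def topDepth (j : splitIndex.Label) (e : ℕ) : (splitIndex.Caps j → Bool) → ℕ := fun c => if c = (fun _ => true) then e else 0

/-- The factors of a PILOT POINT with value `t`: unit factors, the LAST factor `t` on the bad summand `true` and `0` on the good summand
(the sub-packet `𝓘^ℚ(^{S^±_{j+1},j};−)_v` of [IUTchIII] Prop. 3.2 / 3.4 (ii)). [claim: Mochizuki2012, status: disputed] -/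
def pilotFn (t : ℚ) (j : splitIndex.Label) (vQ : splitIndex.VQ) : splitIndex.Caps j → splitShells.Packet1 vQ :=
  fun i v => if i = Fin.last _ then (if v.1 = true then t else 0) else 1

/-- The PILOT POINT `pilotPt t = 1 ⊗ ⋯ ⊗ 1 ⊗ (t·e_true)` of the packet at label `j`. [claim: Mochizuki2012, status: disputed] -/
def pilotPt (t : ℚ) (j : splitIndex.Label) (vQ : splitIndex.VQ) : splitShells.Packet j vQ := splitShells.tprod j vQ (pilotFn t j vQ)

/-- **The Θ-DATUM of P♮ₑ** in `∏_{j ∈ 𝔽_l^⋇}` at a valuation: value `2^{−j²}` at label `j` (Dupuy–Hilado §3.3: `P_{Θ,j} = Σ ord_v(q̲_v^{j²})[v]`;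
[IUTchIII] Prop. 3.5 (ii)(c): the theta values `q^{j²}`). [claim: Mochizuki2012, status: disputed] [cite: DupuyHilado2020, §3.3] -/
def thetaStarE (v : splitIndex.V) : splitShells.StarPacket v := fun j => pilotPt ((2 : ℚ)⁻¹ ^ ((j.1 : ℕ) ^ 2)) j.1 (splitIndex.over v)

/-- **The q-DATUM of P♮ₑ**: value `2^{−1}` at every label, from the SAME Tate datum (Dupuy–Hilado §3.3: `P_q = Σ ord_v(q̲_v)[v]`; the
uninterpreted binder `qK` of abc-iut-w5-d230's pins, here a genuine point of the packet, NOT an ⟨(Ind1)∪(Ind2)⟩-translate of the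
Θ-datum). [claim: Mochizuki2012, status: disputed] [cite: DupuyHilado2020, §3.3] -/
def qStarE (v : splitIndex.V) : splitShells.StarPacket v := fun j => pilotPt (2 : ℚ)⁻¹ j.1 (splitIndex.over v)

/-! ## 4. Data (a)(b)(c), column, full situation -/

/-- **The data (a)(b)(c) of P♮ₑ** ([IUTchIII] Thm. 3.11 (i)): integral structure the unit box `gbox 0`, everything admissible, log-volume
`excVol`, splitting monoid the Θ-datum, number field the whole global packet. [claim: Mochizuki2012, status: disputed] -/
def excData : MRData splitShells where
  shellPk := fun _ _ => gbox 0
  shellSub := fun _ _ => gbox 0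
  Adm := fun _ _ _ => True
  logvol := fun j vQ A => excVol j vQ A
  Ψ := fun v _ => {thetaStarE v}
  act := fun _ _ _ => 0
  Mmod := fun _ => Set.univ

/-- (c)'s global realified Frobenioids: one object, region the unit box, degree its log-volume. [claim: Mochizuki2012, status: disputed] -/
def excDegrees (j : splitIndex.LabelStar) : GlobalDegrees splitShells j where
  ObjMOD := Unit
  Objmod := Unit
  natIso := Equiv.refl Unit
  deg := fun _ => excVol j.1 () (gbox 0)
  region := fun _ _ => gbox 0

/-- The SITUATION of P♮ₑ (bi-coric strictification: the same data on every vertical line). (An `abbrev`.) [claim: Mochizuki2012, status: disputed] -/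
abbrev excSituation : Situation splitIndex where
  L := splitShells
  D := fun _ => excData
  G := fun _ j => excDegrees j

/-- The COLUMN of P♮ₑ: identity Kummer transport at every `(n, m)`, unit-group and ball images the unit box. [claim: Mochizuki2012, status: disputed] -/
def excColumn : Column splitShells where
  frobAdm := fun _ _ _ _ => True
  frobLogvol := fun _ j vQ A => excVol j vQ A
  frobΨ := fun _ v _ => {thetaStarE v}
  frobMmod := fun _ _ => Set.univ
  unitImage := fun _ _ _ _ => gbox 0
  ballImage := fun _ _ _ => gbox 0
  ObjLGP := ℤ
  frobObjLGP := fun _ => ℤ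
  kumLGP := fun _ => Equiv.refl ℤ
  ObjLgp := ℤ
  frobObjLgp := fun _ => ℤ
  kumLgp := fun _ => Equiv.refl ℤ
  thetaPilot := fun _ => 1

/-- The FULL SITUATION of [IUTchIII] Thm. 3.11 for P♮ₑ (link data abc-iut-w5-d247's `naiveLink`). (An `abbrev`.) [claim: Mochizuki2012, status: disputed] -/
abbrev excFull : FullSituation splitIndex where
  toSituation := excSituation
  col := fun _ => excColumn
  link := naiveLink

/-! ## 5. The setting: honest pilot objects, the graded frame, glue reading the exponent -/

/-- `j² ≤ K` for the labels of the bed (`l⋇ = 2`). [folklore] -/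
theorem sq_le_K (j : splitIndex.Label) : (j : ℕ) ^ 2 ≤ K := by
  have hj : (j : ℕ) ≤ 2 := Nat.lt_succ_iff.1 j.2
  calc (j : ℕ) ^ 2 ≤ 2 ^ 2 := Nat.pow_le_pow_left hj 2
    _ = K := rfl

/-- `lastDepth j e ≤ K` when `e ≤ K`. [folklore] -/
theorem lastDepth_le_K (j : splitIndex.Label) {e : ℕ} (he : e ≤ K) (c : splitIndex.Caps j → Bool) : lastDepth j e c ≤ K := by
  unfold lastDepth; split_ifs
  · exact he
  · exact Nat.zero_le _

/-- `topDepth j e ≤ K` when `e ≤ K`. [folklore] -/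
theorem topDepth_le_K (j : splitIndex.Label) {e : ℕ} (he : e ≤ K) (c : splitIndex.Caps j → Bool) : topDepth j e c ≤ K := by
  unfold topDepth; split_ifs
  · exact he
  · exact Nat.zero_le _

/-- The Θ-GLUE reading the object: the lgp-object of exponent `k` at label `j ∈ 𝔽_l^⋇` is the graded box of depth `k·j²` on the last-factor
coordinates (`k = 1` for the pilot); the unit box at the zero label. [claim: Mochizuki2012, status: disputed] -/
def thetaGlue (k : ℤ) (j : splitIndex.Label) (vQ : splitIndex.VQ) : Set (splitShells.Packet j vQ) :=
  if j = 0 then gbox 0 else gbox (lastDepth j (k.toNat * (j : ℕ) ^ 2))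

/-- The q-GLUE reading the object: the `△`-object of exponent `k` at label `j ∈ 𝔽_l^⋇` is the graded box of depth `k` on the last-factor
coordinates; the unit box at the zero label. [claim: Mochizuki2012, status: disputed] -/
def qGlue (k : ℤ) (j : splitIndex.Label) (vQ : splitIndex.VQ) : Set (splitShells.Packet j vQ) :=
  if j = 0 then gbox 0 else gbox (lastDepth j k.toNat)

/-- At exponent `1` the Θ-glue is `gbox (lastDepth j j²)` on `𝔽_l^⋇`. [folklore] -/
theorem thetaGlue_one_of_ne_zero {j : splitIndex.Label} (hj : j ≠ 0) (vQ : splitIndex.VQ) :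
    thetaGlue 1 j vQ = gbox (lastDepth j ((j : ℕ) ^ 2)) := by
  unfold thetaGlue; rw [if_neg hj, Int.toNat_one, one_mul]

/-- At exponent `1` the q-glue is `gbox (lastDepth j 1)` on `𝔽_l^⋇`. [folklore] -/
theorem qGlue_one_of_ne_zero {j : splitIndex.Label} (hj : j ≠ 0) (vQ : splitIndex.VQ) : qGlue 1 j vQ = gbox (lastDepth j 1) := by
  unfold qGlue; rw [if_neg hj, Int.toNat_one]

/-- At the zero label both glues are the unit box. [folklore] -/
theorem glue_zero (k : ℤ) (vQ : splitIndex.VQ) : thetaGlue k 0 vQ = gbox 0 ∧ qGlue k 0 vQ = gbox 0 := ⟨if_pos rfl, if_pos rfl⟩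

/-- `qGlue 1` is a hull-set at every label. [folklore] -/
theorem qGlue_one_mem (j : splitIndex.Label) (vQ : splitIndex.VQ) : qGlue 1 j vQ ∈ excHul j vQ := by
  by_cases hj : j = 0
  · subst hj; rw [(glue_zero 1 vQ).2]; exact ⟨0, fun _ => Nat.zero_le _, rfl⟩
  · rw [qGlue_one_of_ne_zero hj]; exact gbox_mem_excHul vQ (lastDepth_le_K j (by decide) )

/-- **The setting P♮ₑ of Cor. 3.12** over `excSituation` (column `n = 0`): honest object side (abc-iut-w4-d101's `ExpMonoid`, P♮₁'s `splitSig`,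
pilots of exponent `1`), the GRADED frame `excFrame`, glue reading the object. [claim: Mochizuki2012, status: disputed] -/
def excSetting : Setting excSituation where
  n := 0
  HT := ℤ × ℤ
  LogLink := fun _ _ => Unit
  IsFull := fun _ => True
  lattice :=
    { theater := fun n m => (n, m)
      distinct := fun p q h => by simpa using h
      logLink := fun _ _ => ()
      logLink_full := fun _ _ => trivial }
  Frd := Unit
  IsoF := fun _ _ => Unit
  Ob := fun _ => ℤ
  realify := id
  Strip := Unit
  IsoS := fun _ _ => Unit
  M := fun _ _ => ExpMonoid
  sig := splitSig
  split := { Msplit := fun _ _ => ⊤, exists_gen := fun _ _ => ⟨⟨gen, trivial⟩, top_gen_isGenerator⟩ }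
  ObΔ := ℤ
  N := fun _ _ => ExpMonoid
  qData :=
    { q := fun _ _ => gen
      q_gen := fun _ _ => gen_isGenerator
      objOf := fun x => (expOf (x true rfl) : ℤ) }
  frame := fun j vQ => excFrame j vQ
  hul_adm := fun _ _ _ _ => trivial
  thetaRegionOf := fun _ k j vQ => thetaGlue k j vQ
  qRegionOf := fun k j vQ => qGlue k j vQ
  qRegion_mem := fun j vQ => qGlue_one_mem j vQ
  qSupport_finite := fun _ => Set.toFinite _

/-! ## 6. The region operator (reading the datum's depth) and the q-pilot Kummer datum -/

open scoped Classical in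
/-- The DEPTH PROFILE OF A POINT: on a coordinate through which the point passes (`coord c y ≠ 0`) the depth of the point there, on the
other coordinates `0` (no constraint beyond the unit lattice: the pilot's ideal is trivial off the bad summand of the last factor).
[folklore] -/
def pointDepth {j : splitIndex.Label} {vQ : splitIndex.VQ} (y : splitShells.Packet j vQ) (c : splitIndex.Caps j → Bool) : ℕ :=
  if coord j vQ c y = 0 then 0 else depthAt {y} c

/-- **The region operator `ρ` of P♮ₑ**: at a label `j ∈ 𝔽_l^⋇`, the union over the points `ψ` of the datum at the bad valuation of the graded boxes
of their depth profiles; the unit box at the zero label. Defined through the coordinates only, hence equivariant under every family acting by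
capsule permutations — in particular under ⟨(Ind1)∪(Ind2)⟩ (part III). [claim: Mochizuki2012, status: disputed] -/
def gradedRegion (Ψ : ∀ v : splitIndex.V, v ∈ splitIndex.Vbad → Set (splitShells.StarPacket v)) (j : splitIndex.Label)
    (vQ : splitIndex.VQ) : Set (splitShells.Packet j vQ) :=
  if h : j = 0 then gbox 0 else ⋃ ψ ∈ Ψ true rfl, gbox (pointDepth (ψ ⟨j, h⟩))

/-- **The q-pilot's Kummer datum in P♮ₑ**: the q-datum point (value `2^{−1}` at every label). [claim: Mochizuki2012, status: disputed] -/
def qDatumE : ∀ v : splitIndex.V, v ∈ splitIndex.Vbad → Set (splitShells.StarPacket v) := fun v _ => {qStarE v}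

end ExcursionWitness

end Summit.ABC.IUTFork.Cor312Vol

end
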